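import Summits.AtomisticToContinuum.HydrodynamicLimit.Theorems.JParityClosureEvenStressEnskogMeanEnskogRung0Helper
import Summits.AtomisticToContinuum.HydrodynamicLimit.Theorems.InformationPercolationEngineCollisionRateTubeRegular
import Literature.MathematicalPhysics.KineticTheory.CollisionTubeMeanRung0SpeedCutoffMark
import Literature.MathematicalPhysics.KineticTheory.EnskogRateMeanRung0BoundedMark
import Literature.MathematicalPhysics.StatisticalMechanics.HardSphereContactTheoremProofs
import HarnessLib

/-!
# R3 · the time-integrated MEAN of the even tube functional at rung 0, unit mark — UNCONDITIONAL
# (`stub_meanEnskogUnitRung0`, line `Sketch`, crux `InformationPercolationEngine.CollisionRate`,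
# stmt-AtomisticToContinuum-13481)

RUNG 0 = constant profiles `(a, u, θ)`: the local Gibbs law is the homogeneous canonical Gibbs law `G_N`, invariant
under every hard-sphere flow (`Theorems.integral_comp_flow_localGibbsLaw_const`), so the time-integrated mean
`∫₀^τ E_{G_N}[W_t ∘ Φ_t] dt` of the even tube functional `W_t = A_t − σ³ e_t` at the speed-truncated unit mark
`Ξ₁ᴸ(n, v, w) = ψ_L(‖w − v‖)` is the STATIC quantity `∫₀^τ (E A_t − σ³ E e_t) dt`.  The Enskog side `E e_t` tends
to `(∫χ(t,·)) g(σ³) Y(σ³) Θ̄` (`Literature.….tendsto_integral_enskogRate_rung0_of_psi`, mark-generic twin of the sibling's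
H4, the equation of state `HsEosLowDensity` being a tree theorem) and the tube side `E A_t` is within `η/(2τ)` of `σ³ g(σ³) Y(σ³) Θ̄ ∫χ(t,·)`
uniformly on `[0, τ]` (`Literature.….forall_abs_integral_tubeStat_sub_le_of_contact`, mark-generic twin of the
sibling's H5, where the grazing hypothesis of the double-sum form is replaced by the almost-sure one), GIVEN the
canonical contact theorem — which is now the tree theorem
`Literature.MathematicalPhysics.StatisticalMechanics.HardSphereContactTheorem_holds`, bridged to phase space by
`Theorems.EvenStressEnskog.contactStatementLG_of_contactTheorem`.  Hence R3 holds unconditionally; the assembly is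
that of `Theorems.EvenStressEnskog.meanEnskogRung0_of_tubeMean` at the single mark `Ξ₁ᴸ`
(regularity from `evenTubeStatRegular_one`, dominated convergence in `t` on the Enskog side).
-/

noncomputable section

open MeasureTheory Set Filter Topology
open scoped ENNReal InnerProductSpace BigOperators Pointwise

namespace Summit.AtomisticToContinuum.HydrodynamicLimit.Theorems.CollisionRate

open Literature.Analysis.FluidPDE Literature.MathematicalPhysics.KineticTheory
open Summit.AtomisticToContinuum.HydrodynamicLimit.Theorems.EvenStressEnskog

/-- **R3 · the time-integrated mean of the even tube functional at rung 0, unit mark, UNCONDITIONAL**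
(registered rung-0 stub `stub_meanEnskogUnitRung0` of the line `Sketch`, verbatim): under the canonical law of
constant profiles the time-integrated Gibbs mean of `W_t ∘ Φ_t`, `W_t = evenTubeStat σ N χ g Ξ₁ᴸ r κ t`, is at most
`η` for `r < 1/4`, `κ < κ₀(η, L)` and `N ≥ N₀` — tube side and Enskog side both tend to
`σ³ g(σ³) Y(σ³) Θ̄(Ξ₁ᴸ) ∫∫χ`, the contact theorem being a tree theorem. -/
theorem stub_meanEnskogUnitRung0 :
    ∃ η₀ : ℝ, 0 < η₀ ∧ ∀ (ab θb : ℝ) (ub : V3), 0 < ab → 0 < θb → ∃ σ₀ : ℝ, 0 < σ₀ ∧ ∀ σ : ℝ, 0 < σ → σ < σ₀ →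
      ∀ Φ : (N : ℕ) → HardSphereFlow (Torus.geometry (Fin 3)) (hsDiameter σ N) (N + 1),
      ∀ τ : ℝ, 0 < τ → ∀ χ : ℝ × T3 → ℝ, Continuous χ → ∀ g : ℝ → ℝ, Continuous g →
      (∀ x, η₀ ≤ x → g x = 0) →
      ∀ η : ℝ, 0 < η → ∃ r₀ : ℝ, 0 < r₀ ∧ ∀ r : ℝ, 0 < r → r < r₀ →
      ∀ L : ℝ, 1 ≤ L → ∃ κ₀ : ℝ, 0 < κ₀ ∧ ∀ κ : ℝ, 0 < κ → κ < κ₀ → ∃ N₀ : ℕ, ∀ N : ℕ, N₀ ≤ N →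
        |∫ t in Set.Icc (0 : ℝ) τ,
            ∫ z, evenTubeStat σ N χ g (fun q : V3 × V3 × V3 => speedCutoff L ‖q.2.2 - q.2.1‖) r κ t ((Φ N).flow t z)
              ∂(localGibbsLaw σ (fun _ => ab) (fun _ => ub) (fun _ => θb) N (Φ N))| ≤ η := by
  obtain ⟨η₆, hη₆, H6⟩ := evenTubeStatRegular_one
  -- the Enskog side: equation of state (analyticity radius `η'`), smallness `σ₄` of the uniform gas
  obtain ⟨η', hη', F, hF, hEq, -, -, -⟩ := hsEosLowDensity_JParityClosure
  obtain ⟨σ₄, hσ₄, hsmall⟩ := exists_smallDensity uniformProfile one_pos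
  set η₄ : ℝ := η' / 2 with hη₄def
  have hη₄ : 0 < η₄ := by positivity
  obtain ⟨η₅, hη₅, σ₅, hσ₅, H5⟩ := forall_abs_integral_tubeStat_sub_le_of_contact
    (contactStatementLG_of_contactTheorem Literature.MathematicalPhysics.StatisticalMechanics.HardSphereContactTheorem_holds)
  obtain ⟨ηY, hηY, HY⟩ := exists_bound_mul_contactValue hsEosLowDensity_JParityClosure
  refine ⟨min (min (min η₄ η₅) η₆) ηY, lt_min (lt_min (lt_min hη₄ hη₅) hη₆) hηY, ?_⟩
  intro a θ u ha hθ
  refine ⟨min (min σ₄ σ₅) (min (1 / 2) (min η₄ η₅)),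
    lt_min (lt_min hσ₄ hσ₅) (lt_min (by norm_num) (lt_min hη₄ hη₅)), ?_⟩
  intro σ hσ hσlt Φ τ hτ χ hχ g hg hg0 η hη
  -- thresholds
  have hσ4 : σ < σ₄ := lt_of_lt_of_le hσlt ((min_le_left _ _).trans (min_le_left _ _))
  have hσ5 : σ < σ₅ := lt_of_lt_of_le hσlt ((min_le_left _ _).trans (min_le_right _ _))
  have hσhalf : σ ≤ 1 / 2 := (lt_of_lt_of_le hσlt ((min_le_right _ _).trans (min_le_left _ _))).le
  have hση : σ < min η₄ η₅ := lt_of_lt_of_le hσlt ((min_le_right _ _).trans (min_le_right _ _))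
  have hσ3 : σ ^ 3 ≤ σ := pow_le_of_le_one hσ.le (by linarith) (by norm_num)
  have hσcube4 : σ ^ 3 < η₄ := lt_of_le_of_lt hσ3 (lt_of_lt_of_le hση (min_le_left _ _))
  have hσcube5 : σ ^ 3 < η₅ := lt_of_le_of_lt hσ3 (lt_of_lt_of_le hση (min_le_right _ _))
  have hg5 : ∀ b, η₅ ≤ b → g b = 0 := fun b hb =>
    hg0 b ((((min_le_left _ _).trans (min_le_left _ _)).trans (min_le_right _ _)).trans hb)
  have hg6 : ∀ b, η₆ ≤ b → g b = 0 := fun b hb =>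
    hg0 b (((min_le_left _ _).trans (min_le_right _ _)).trans hb)
  have hgY : ∀ b, ηY ≤ b → g b = 0 := fun b hb => hg0 b ((min_le_right _ _).trans hb)
  obtain ⟨CgY, hCgY0, hCgY⟩ := HY g hg hgY
  have hsd : SmallDensity uniformProfile σ := (hsmall σ hσ hσ4).1
  -- `ψ = g · Y` is continuous at `σ³ ∈ (0, η')` (`f_ex = F` analytic on the open band)
  have hψc : ContinuousAt (fun b => g b * contactValue b) (σ ^ 3) := by
    have hs : 0 < σ ^ 3 := pow_pos hσ 3
    have hs' : σ ^ 3 < η' := by rw [hη₄def] at hσcube4; linarith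
    have hnhds : hsExcessFreeEnergy =ᶠ[𝓝 (σ ^ 3)] F :=
      Filter.eventuallyEq_of_mem (isOpen_Ioo.mem_nhds ⟨hs, hs'⟩) (hEq.mono Ioo_subset_Ico_self)
    have hYF : (fun b => 3 / (2 * Real.pi) * deriv F b) =ᶠ[𝓝 (σ ^ 3)] contactValue :=
      hnhds.deriv.mono fun b hb => by rw [contactValue, hb]
    have hFc : ContinuousAt (deriv F) (σ ^ 3) :=
      hF.deriv.continuousOn.continuousAt (isOpen_Ioo.mem_nhds ⟨by linarith, hs'⟩)
    exact hg.continuousAt.mul ((hFc.const_mul _).congr hYF)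
  -- a uniform bound for `χ` on `[0, τ] × 𝕋³`
  have hKc : IsCompact (Set.Icc (0 : ℝ) τ ×ˢ (univ : Set (UnitAddTorus (Fin 3)))) :=
    isCompact_Icc.prod isCompact_univ
  obtain ⟨Cχ, hCχ⟩ := hKc.exists_bound_of_continuousOn hχ.continuousOn
  have hχb : ∀ t ∈ Set.Icc (0 : ℝ) τ, ∀ x, |χ (t, x)| ≤ Cχ := fun t ht x => by
    simpa only [Real.norm_eq_abs] using hCχ (t, x) ⟨ht, mem_univ _⟩
  -- the law
  set G : (N : ℕ) → Measure (Config (N + 1) (Fin 3) T3) :=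
    fun N => localGibbsLaw σ (fun _ => a) (fun _ => u) (fun _ => θ) N (Φ N) with hG
  have hPN : ∀ N, IsProbabilityMeasure (G N) := fun N =>
    isProbabilityMeasure_localGibbsLaw continuous_const continuous_const continuous_const
      (fun _ => ha) (fun _ => hθ) hσhalf N (Φ N)
  refine ⟨1 / 4, by norm_num, ?_⟩
  intro r hr hrlt L hL
  have hLpos : (0 : ℝ) < L := zero_lt_one.trans_le hL
  -- the mark `Ξ₁ᴸ`: continuous, bounded by `1 ≤ 2L`, vanishing at relative speed `≥ 2L`, `|Θ Ξ₁ᴸ| ≤ 2L|S²|`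
  set Ξ : V3 × V3 × V3 → ℝ := fun q => speedCutoff L ‖q.2.2 - q.2.1‖ with hΞdef
  have hΞc : Continuous Ξ := continuous_speedCutoff_mark L
  have hΞb : ∀ p, |Ξ p| ≤ 2 * L := fun p => (abs_speedCutoff_le_one L _).trans (by linarith)
  have hΞL : ∀ m v v' : V3, 2 * L ≤ ‖v - v'‖ → Ξ (m, v, v') = 0 := fun m v v' h => by
    rw [norm_sub_rev] at h
    exact speedCutoff_eq_zero hLpos h
  set CΘ : ℝ := 2 * L * sphereMass V3 with hCΘ
  have hΘle : ∀ v w, |sphereMark Ξ v w| ≤ CΘ := fun v w => abs_sphereMark_speedCutoff_le hLpos v w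
  -- the uniform Enskog bound
  set CE : ℝ := Cχ * CgY * ((3 / (Real.pi * r ^ 3)) ^ 2 * CΘ) *
    (volume : Measure (UnitAddTorus (Fin 3))).real univ with hCE
  have hEbound : ∀ (N : ℕ), ∀ t ∈ Set.Icc (0 : ℝ) τ, ∀ z,
      |enskogRate σ N χ g Ξ r t z| ≤ CE := fun N t ht z =>
    abs_enskogRate_le_of_abs_sphereMark_le_const (hχb t ht) hCgY hσ.le hΘle hr N z
  set Θb : ℝ := ∫ p : V3 × V3, sphereMark Ξ p.1 p.2 *
    (localMaxwellian 1 θ u p.1 * localMaxwellian 1 θ u p.2) with hΘb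
  set I : ℝ := ∫ t in Set.Icc (0 : ℝ) τ, ∫ x : UnitAddTorus (Fin 3), χ (t, x) with hI
  -- the tube side: H5 at accuracy η/2
  obtain ⟨κ₀, hκ₀, H5'⟩ := H5 σ a θ u τ χ g L r Ξ hσ hσ5 hσcube5 ha hθ hτ hχ hg hg5 hL hr hrlt hΞc hΞb hΞL
    (η / 2) (by positivity)
  refine ⟨κ₀, hκ₀, fun κ hκ hκlt => ?_⟩
  obtain ⟨N₅, hN₅⟩ := H5' κ hκ hκlt Φ
  -- the Enskog side: H4 pointwise in `t`, then dominated convergence in `t`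
  have h4t : ∀ t : ℝ, Tendsto (fun N : ℕ => ∫ z, enskogRate σ N χ g Ξ r t z ∂(G N))
      atTop (𝓝 ((∫ x : UnitAddTorus (Fin 3), χ (t, x)) * g (σ ^ 3) * contactValue (σ ^ 3) * Θb)) :=
    fun t => tendsto_integral_enskogRate_rung0_of_psi hsd ha hθ hχ hg hCgY hψc hΞc hΘle hr (by linarith) t Φ
  -- joint measurability of `(t, z) ↦ e_t(z)` for each `N` (via `e = σ⁻³ (A − W)`)
  have hmeasE : ∀ N, Measurable (fun p : ℝ × Config (N + 1) (Fin 3) T3 =>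
      enskogRate σ N χ g Ξ r p.1 p.2) := by
    intro N
    obtain ⟨hmeasW, -⟩ := H6 σ N χ g L r κ τ hσ hχ hg hg6 hLpos hr hκ.le
    have hmeasA := Summit.AtomisticToContinuum.HydrodynamicLimit.Theorems.measurable_tubeStat_uncurry σ N
      hχ hg hΞc r r 1 κ
    have hσ3ne : σ ^ 3 ≠ 0 := pow_ne_zero 3 hσ.ne'
    have heq : (fun p : ℝ × Config (N + 1) (Fin 3) T3 => enskogRate σ N χ g Ξ r p.1 p.2)
        = fun p => (σ ^ 3)⁻¹ * (tubeStat σ N χ g Ξ r r 1 κ p.1 p.2 -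
            evenTubeStat σ N χ g Ξ r κ p.1 p.2) := by
      funext p
      rw [evenTubeStat_def]
      field_simp
      ring
    rw [heq]
    exact (hmeasA.sub hmeasW).const_mul _
  -- the `t ↦ E e_t` are measurable and uniformly bounded on `[0, τ]`
  have hFmeas : ∀ N, AEStronglyMeasurable
      (fun t => ∫ z, enskogRate σ N χ g Ξ r t z ∂(G N))
      (volume.restrict (Set.Icc (0 : ℝ) τ)) := fun N =>
    ((hmeasE N).stronglyMeasurable.integral_prod_right' (ν := G N)).aestronglyMeasurable
  have hFbound : ∀ N, ∀ᵐ t ∂(volume.restrict (Set.Icc (0 : ℝ) τ)),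
      ‖∫ z, enskogRate σ N χ g Ξ r t z ∂(G N)‖ ≤ CE := by
    intro N
    haveI := hPN N
    filter_upwards [ae_restrict_mem measurableSet_Icc] with t ht
    have h := norm_integral_le_of_norm_le_const (μ := G N)
      (f := fun z => enskogRate σ N χ g Ξ r t z) (C := CE)
      (Eventually.of_forall fun z => by simpa only [Real.norm_eq_abs] using hEbound N t ht z)
    simpa only [probReal_univ, mul_one] using h
  have hDCT : Tendsto (fun N : ℕ => ∫ t in Set.Icc (0 : ℝ) τ,
        ∫ z, enskogRate σ N χ g Ξ r t z ∂(G N)) atTop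
      (𝓝 (∫ t in Set.Icc (0 : ℝ) τ,
        (∫ x : UnitAddTorus (Fin 3), χ (t, x)) * g (σ ^ 3) * contactValue (σ ^ 3) * Θb)) :=
    tendsto_integral_of_dominated_convergence (fun _ => CE) hFmeas (integrable_const CE) hFbound
      (Eventually.of_forall h4t)
  have hlim : ∫ t in Set.Icc (0 : ℝ) τ,
      (∫ x : UnitAddTorus (Fin 3), χ (t, x)) * g (σ ^ 3) * contactValue (σ ^ 3) * Θb
      = g (σ ^ 3) * contactValue (σ ^ 3) * Θb * I := by
    rw [hI, ← integral_const_mul]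
    refine integral_congr_ae (Eventually.of_forall fun t => ?_)
    simp only
    ring
  rw [hlim] at hDCT
  obtain ⟨N₄, hN₄⟩ := Metric.tendsto_atTop.1 hDCT (η / 2 / σ ^ 3) (by positivity)
  refine ⟨max N₄ N₅, fun N hN => ?_⟩
  have hN4' := hN₄ N ((le_max_left _ _).trans hN)
  have hN5' := hN₅ N ((le_max_right _ _).trans hN)
  haveI := hPN N
  -- regularity of `W` (S6) and `A` (tree) for this `N`
  obtain ⟨hmeasW, BW, hBW⟩ := H6 σ N χ g L r κ τ hσ hχ hg hg6 hLpos hr hκ.le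
  have hmeasA := Summit.AtomisticToContinuum.HydrodynamicLimit.Theorems.measurable_tubeStat_uncurry σ N
    hχ hg hΞc r r 1 κ
  obtain ⟨BA, hBA⟩ := Summit.AtomisticToContinuum.HydrodynamicLimit.Theorems.exists_bound_tubeStat σ N
    hχ hg ⟨2 * L, hΞb⟩ hr r zero_le_one hκ.le τ
  have hmeasWt : ∀ t, Measurable (fun z => evenTubeStat σ N χ g Ξ r κ t z) :=
    fun t => Measurable.of_uncurry_left
      (f := fun (t : ℝ) (z : Config (N + 1) (Fin 3) T3) => evenTubeStat σ N χ g Ξ r κ t z)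
      hmeasW
  have hmeasAt : ∀ t, Measurable (fun z => tubeStat σ N χ g Ξ r r 1 κ t z) :=
    fun t => Measurable.of_uncurry_left
      (f := fun (t : ℝ) (z : Config (N + 1) (Fin 3) T3) => tubeStat σ N χ g Ξ r r 1 κ t z)
      hmeasA
  have hmeasEt : ∀ t, Measurable (fun z => enskogRate σ N χ g Ξ r t z) :=
    fun t => Measurable.of_uncurry_left
      (f := fun (t : ℝ) (z : Config (N + 1) (Fin 3) T3) => enskogRate σ N χ g Ξ r t z)
      (hmeasE N)
  -- stationarity: the flow disappears under the Gibbs mean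
  have hstat : ∀ t, ∫ z, evenTubeStat σ N χ g Ξ r κ t ((Φ N).flow t z) ∂(G N)
      = ∫ z, evenTubeStat σ N χ g Ξ r κ t z ∂(G N) := fun t =>
    integral_comp_flow_localGibbsLaw_const σ a θ u N (Φ N) t (hmeasWt t).aestronglyMeasurable
  -- decomposition of the static mean at each `t ∈ [0, τ]`
  have hdec : ∀ t ∈ Set.Icc (0 : ℝ) τ,
      ∫ z, evenTubeStat σ N χ g Ξ r κ t z ∂(G N)
        = (∫ z, tubeStat σ N χ g Ξ r r 1 κ t z ∂(G N))
          - σ ^ 3 * ∫ z, enskogRate σ N χ g Ξ r t z ∂(G N) := by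
    intro t ht
    have hiA : Integrable (fun z => tubeStat σ N χ g Ξ r r 1 κ t z) (G N) :=
      Integrable.of_bound (hmeasAt t).aestronglyMeasurable BA
        (Eventually.of_forall fun z => by simpa only [Real.norm_eq_abs] using hBA t ht z)
    have hiE : Integrable (fun z => σ ^ 3 * enskogRate σ N χ g Ξ r t z) (G N) :=
      (Integrable.of_bound (hmeasEt t).aestronglyMeasurable CE
        (Eventually.of_forall fun z => by
          simpa only [Real.norm_eq_abs] using hEbound N t ht z)).const_mul _
    simp_rw [evenTubeStat_def]
    rw [integral_sub hiA hiE, integral_const_mul]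
  -- the time integral of the static mean splits
  have hiAt : Integrable (fun t => ∫ z, tubeStat σ N χ g Ξ r r 1 κ t z ∂(G N))
      (volume.restrict (Set.Icc (0 : ℝ) τ)) := by
    refine Integrable.of_bound
      ((hmeasA.stronglyMeasurable.integral_prod_right' (ν := G N)).aestronglyMeasurable) BA ?_
    filter_upwards [ae_restrict_mem measurableSet_Icc] with t ht
    have h := norm_integral_le_of_norm_le_const (μ := G N)
      (f := fun z => tubeStat σ N χ g Ξ r r 1 κ t z) (C := BA)
      (Eventually.of_forall fun z => by simpa only [Real.norm_eq_abs] using hBA t ht z)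
    simpa only [probReal_univ, mul_one] using h
  have hiEt : Integrable (fun t => σ ^ 3 * ∫ z, enskogRate σ N χ g Ξ r t z ∂(G N))
      (volume.restrict (Set.Icc (0 : ℝ) τ)) :=
    (Integrable.of_bound (hFmeas N) CE (hFbound N)).const_mul _
  have hsplit : ∫ t in Set.Icc (0 : ℝ) τ,
        ∫ z, evenTubeStat σ N χ g Ξ r κ t ((Φ N).flow t z) ∂(G N)
      = (∫ t in Set.Icc (0 : ℝ) τ, ∫ z, tubeStat σ N χ g Ξ r r 1 κ t z ∂(G N))
        - σ ^ 3 * ∫ t in Set.Icc (0 : ℝ) τ,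
            ∫ z, enskogRate σ N χ g Ξ r t z ∂(G N) := by
    rw [← integral_const_mul, ← integral_sub hiAt hiEt]
    refine setIntegral_congr_fun measurableSet_Icc fun t ht => ?_
    rw [hstat t, hdec t ht]
  -- the estimate
  rw [hsplit]
  set EA : ℝ := ∫ t in Set.Icc (0 : ℝ) τ, ∫ z, tubeStat σ N χ g Ξ r r 1 κ t z ∂(G N)
    with hEA
  set EE : ℝ := ∫ t in Set.Icc (0 : ℝ) τ, ∫ z, enskogRate σ N χ g Ξ r t z ∂(G N)
    with hEE
  have h5 : |EA - σ ^ 3 * g (σ ^ 3) * contactValue (σ ^ 3) * Θb * I| ≤ η / 2 := by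
    have h := abs_setIntegral_sub_mul_setIntegral_le_of_forall hτ.le hiAt
      (integrableOn_integral_of_continuous hχ τ) hN5'
    have e : η / 2 / τ * τ = η / 2 := by field_simp
    rw [e] at h
    exact h
  have h4 : |EE - g (σ ^ 3) * contactValue (σ ^ 3) * Θb * I| < η / 2 / σ ^ 3 := by
    rw [← Real.dist_eq]; exact hN4'
  have hσ3pos : 0 < σ ^ 3 := pow_pos hσ 3
  have h4' : σ ^ 3 * |EE - g (σ ^ 3) * contactValue (σ ^ 3) * Θb * I| ≤ η / 2 := by
    have h := mul_lt_mul_of_pos_left h4 hσ3pos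
    have hc : σ ^ 3 * (η / 2 / σ ^ 3) = η / 2 := by field_simp
    rw [hc] at h
    exact h.le
  calc |EA - σ ^ 3 * EE|
      = |(EA - σ ^ 3 * g (σ ^ 3) * contactValue (σ ^ 3) * Θb * I)
          - σ ^ 3 * (EE - g (σ ^ 3) * contactValue (σ ^ 3) * Θb * I)| := by ring_nf
    _ ≤ |EA - σ ^ 3 * g (σ ^ 3) * contactValue (σ ^ 3) * Θb * I|
          + |σ ^ 3 * (EE - g (σ ^ 3) * contactValue (σ ^ 3) * Θb * I)| := abs_sub _ _
    _ = |EA - σ ^ 3 * g (σ ^ 3) * contactValue (σ ^ 3) * Θb * I|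
          + σ ^ 3 * |EE - g (σ ^ 3) * contactValue (σ ^ 3) * Θb * I| := by
        rw [abs_mul, abs_of_pos hσ3pos]
    _ ≤ η / 2 + η / 2 := add_le_add h5 h4'
    _ = η := by ring

end Summit.AtomisticToContinuum.HydrodynamicLimit.Theorems.CollisionRate

end
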